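import Summits.HodgeConjecture.CorCM.CyclotomicTwoPowerPNormDescent
import Mathlib.RingTheory.ZMod.Torsion
import Mathlib.FieldTheory.IntermediateField.Adjoin.Basic
import Mathlib.RingTheory.Localization.Integral
import Mathlib.NumberTheory.LegendreSymbol.Basic
import HarnessLib

/-!
# A primitive `2^{a+1}`-th root of unity is not a norm from `ℚ(ζ_{2^{a+1}p})` to the fixed field of `ζ ↦ ζ^{2p−1}` when
# `p ≡ 2^{a+1} + 1 (mod 2^{a+2})` — inside `ℂ`

COR-CM (cell `pub-hodgecm2`), binder seat b04 (gen 25), count-neutral claim CYCLIC-SEMIDIRECT-TWO-POWER, part IIIc (the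
`2^{a+1}`-analogue of `CorCM/CyclotomicFourPNormObstruction`): the arithmetic hypothesis `hN` of parts I–II
(`CorCM/GaloisCyclicSemidirectTwoPowerTwoSheet`, `…Nondegenerate`) discharged for `M = ℚ(ζ_{2^{a+1}p}) ⊆ ℂ` and the embedding
`ρ : ζ ↦ ζ^{2p−1}` (fixing `μ_{2^{a+1}}`, inverting `μ_p`), from the descent of part IIIb.  Mathlib only.  KERNEL ONLY:
theorems; no definition, no named fact, no `sorry`.

THEOREM (`exists_subfield_rho`).  For every prime `p` with `p mod 2^{a+2} = 2^{a+1} + 1` (i.e. `v₂(p − 1) = a + 1`) there are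
a subfield `M ⊆ ℂ` containing `μ_{2^{a+1}p}` and a ring map `ρ : M → ℂ` with `ρ(z) = z` for `z^{2^{a+1}} = 1`, `ρ(z) = z⁻¹`
for `z^p = 1`, such that `z₁ ρ(z₁) = ω · z₂ ρ(z₂)`, `ω^{2^a} = −1 ⟹ z₁ = z₂ = 0`.  (The local obstruction at the primes above
`p`: the residue field is `𝔽_p` and a primitive `2^{a+1}`-th root of unity is a square there iff `2^{a+2} ∣ p − 1`.)

* §1 `exp_pow_two_pow_mul` (`ζ^{2^a p} = −1`), `eq_pow_odd_of_pow_eq_neg_one` (`ω^{2^a} = −1 ⟹ ω = ζ^{pj}`, `j` odd),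
  `exists_pow_two_pow_eq_neg_one` (`∃ s ∈ 𝔽_p, s^{2^a} = −1`).
* §2 **`exists_subfield_rho`**.

## References

* [FeinGordonSmith1971] B. Fein, B. Gordon, J. H. Smith, J. Number Theory 3 (1971), 310–315.
* [Washington1997] L. C. Washington, *Introduction to Cyclotomic Fields*, Thm. 2.13.
-/

noncomputable section

open Polynomial IntermediateField

namespace Summit.HodgeConjecture.CorCM.CyclotomicTwoPowerP

variable {p a : ℕ}

/-! ## §1 Roots of unity in `ℚ(ζ_{2^{a+1}p}) ⊆ ℂ` and in `𝔽_p` -/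

/-- `ζ^{2^a p} = −1` for the primitive `2^{a+1}p`-th root `ζ = e^{2πi/2^{a+1}p}`. [folklore] -/
theorem exp_pow_two_pow_mul (hp : 0 < p) :
    Complex.exp (2 * Real.pi * Complex.I / (2 ^ (a + 1) * p : ℕ)) ^ (2 ^ a * p) = -1 := by
  have h := congrArg (AdjoinRoot.lift (algebraMap ℤ ℂ) _ (eval₂_cyclotomic_exp (a := a) hp)) (root_pow_eq_neg_one (a := a) hp)
  rwa [map_pow, AdjoinRoot.lift_root, map_neg, map_one] at h

/-- `ω^{2^a} = −1` in `ℂ` forces `ω = ζ^{pj}` with `j` odd. [folklore] -/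
theorem eq_pow_odd_of_pow_eq_neg_one (hp : p.Prime) (hp2 : p ≠ 2) {ω : ℂ} (hω : ω ^ 2 ^ a = -1) :
    ∃ j : ℕ, Odd j ∧ ω = Complex.exp (2 * Real.pi * Complex.I / (2 ^ (a + 1) * p : ℕ)) ^ (p * j) := by
  have hζ := Complex.isPrimitiveRoot_exp (2 ^ (a + 1) * p) (by have := hp.pos; positivity)
  haveI : NeZero (2 ^ (a + 1) * p) := ⟨by have := hp.pos; positivity⟩
  set ζ := Complex.exp (2 * Real.pi * Complex.I / (2 ^ (a + 1) * p : ℕ))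
  have hω2 : ω ^ 2 ^ (a + 1) = 1 := by rw [pow_succ, pow_mul, hω, neg_one_sq]
  have hωn : ω ^ (2 ^ (a + 1) * p) = 1 := by rw [pow_mul, hω2, one_pow]
  obtain ⟨m, hm, rfl⟩ := hζ.eq_pow_of_pow_eq_one hωn
  rw [← pow_mul] at hω2
  have hdvd : 2 ^ (a + 1) * p ∣ m * 2 ^ (a + 1) := hζ.dvd_of_pow_eq_one _ hω2
  obtain ⟨j, hj⟩ : p ∣ m := by
    have : p ∣ m * 2 ^ (a + 1) := Dvd.dvd.trans (Dvd.intro_left _ rfl) hdvd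
    rcases (Nat.Prime.dvd_mul hp).1 this with h | h
    · exact h
    · exact absurd ((Nat.prime_dvd_prime_iff_eq hp Nat.prime_two).1 (hp.dvd_of_dvd_pow h)) hp2
  refine ⟨j, ?_, by rw [hj]⟩
  by_contra hev
  rw [Nat.not_odd_iff_even] at hev
  rw [hj, ← pow_mul, show p * j * 2 ^ a = 2 ^ a * p * j by ring, pow_mul, exp_pow_two_pow_mul hp.pos, hev.neg_one_pow]
    at hω
  norm_num at hω

/-- **A primitive `2^{a+1}`-th root of unity in `𝔽_p`** when `2^{a+1} ∣ p − 1`: `∃ s, s^{2^a} = −1`. [folklore] -/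
theorem exists_pow_two_pow_eq_neg_one (hp : p.Prime) (hdvd : 2 ^ (a + 1) ∣ p - 1) : ∃ s : ZMod p, s ^ 2 ^ a = -1 := by
  haveI : Fact p.Prime := ⟨hp⟩
  haveI : NeZero (p - 1) := ⟨by have := hp.two_le; omega⟩
  haveI := HasEnoughRootsOfUnity.of_dvd (ZMod p) hdvd
  obtain ⟨s, hs⟩ := HasEnoughRootsOfUnity.exists_primitiveRoot (ZMod p) (2 ^ (a + 1))
  refine ⟨s, ?_⟩
  have h1 : s ^ 2 ^ a * s ^ 2 ^ a = 1 := by rw [← pow_two, ← pow_mul, ← pow_succ, hs.pow_eq_one]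
  have hne : s ^ 2 ^ a ≠ 1 := by
    intro h
    have := Nat.le_of_dvd (by positivity) (hs.dvd_of_pow_eq_one _ h)
    have : 2 ^ a < 2 ^ (a + 1) := Nat.pow_lt_pow_right (by norm_num) (by omega)
    omega
  rcases mul_self_eq_one_iff.1 h1 with h | h
  · exact absurd h hne
  · exact h

/-! ## §2 The subfield `ℚ(ζ_{2^{a+1}p})` and the embedding `ρ : ζ ↦ ζ^{2p−1}` -/

/-- **THE NORM OBSTRUCTION.**  `p mod 2^{a+2} = 2^{a+1} + 1` prime.  With `M = ℚ(ζ_{2^{a+1}p}) ⊆ ℂ` and `ρ : M → ℂ`,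
`ζ ↦ ζ^{2p−1}`: `M ⊇ μ_{2^{a+1}p}`, `ρ` fixes `μ_{2^{a+1}}` and inverts `μ_p`, and `z₁ ρ(z₁) = ω z₂ ρ(z₂)` with `ω^{2^a} = −1`
forces `z₁ = z₂ = 0` — a primitive `2^{a+1}`-th root of unity is not a norm from `ℚ(ζ_{2^{a+1}p})` to the fixed field of `ρ`.
[cite: FeinGordonSmith1971, pp. 310–315] -/
theorem exists_subfield_rho (hp : p.Prime) (hpa : p % 2 ^ (a + 2) = 2 ^ (a + 1) + 1) :
    ∃ (M : Subfield ℂ) (ρ : M →+* ℂ), (∀ z : ℂ, z ^ (2 ^ (a + 1) * p) = 1 → z ∈ M) ∧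
      (∀ z : M, (z : ℂ) ^ 2 ^ (a + 1) = 1 → ρ z = z) ∧ (∀ z : M, (z : ℂ) ^ p = 1 → ρ z = (z : ℂ)⁻¹) ∧
      (∀ (z₁ z₂ : M) (ω : ℂ), ω ^ 2 ^ a = -1 → (z₁ : ℂ) * ρ z₁ = ω * ((z₂ : ℂ) * ρ z₂) →
        (z₁ : ℂ) = 0 ∧ (z₂ : ℂ) = 0) := by
  classical
  obtain ⟨t, ht⟩ := exists_eq_two_pow_mul hpa
  have hp2 : p ≠ 2 := by
    rintro rfl
    have h2 : 2 ≤ 2 ^ (a + 1) := by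
      have : 2 ^ 1 ≤ 2 ^ (a + 1) := Nat.pow_le_pow_right (by norm_num) (by omega)
      simpa using this
    nlinarith
  have hp0 : 0 < p := hp.pos
  haveI : NeZero (2 ^ (a + 1) * p) := ⟨by positivity⟩
  haveI : Fact p.Prime := ⟨hp⟩
  have hζ := Complex.isPrimitiveRoot_exp (2 ^ (a + 1) * p) (by positivity)
  set ζ := Complex.exp (2 * Real.pi * Complex.I / (2 ^ (a + 1) * p : ℕ)) with hζ_def
  have hζint : IsIntegral ℚ ζ := (hζ.isIntegral (by positivity)).tower_top
  -- the power basis of `ℚ⟮ζ⟯` and the embedding `ρ₀ : ζ ↦ ζ^{2p-1}`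
  set pb := IntermediateField.adjoin.powerBasis hζint with hpb_def
  have hgen : pb.gen = AdjoinSimple.gen ℚ ζ := IntermediateField.adjoin.powerBasis_gen hζint
  have hmin : minpoly ℚ pb.gen = cyclotomic (2 ^ (a + 1) * p) ℚ := by
    rw [hgen, cyclotomic_eq_minpoly_rat hζ (by positivity)]
    exact IntermediateField.minpoly_gen (F := ℚ) ζ
  have hρ₀ : aeval (ζ ^ (2 * p - 1)) (minpoly ℚ pb.gen) = 0 := by
    rw [hmin, aeval_def, eval₂_eq_eval_map, map_cyclotomic, ← IsRoot.def, isRoot_cyclotomic_iff]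
    exact hζ.pow_of_coprime _ (coprime_two_mul_sub_one hp0)
  set ρ₀ : ℚ⟮ζ⟯ →ₐ[ℚ] ℂ := pb.lift (ζ ^ (2 * p - 1)) hρ₀ with hρ₀_def
  have hρ₀gen : ρ₀ (AdjoinSimple.gen ℚ ζ) = ζ ^ (2 * p - 1) := by
    have h := pb.lift_gen (ζ ^ (2 * p - 1)) hρ₀
    rw [hgen] at h
    exact h
  -- powers of `ζ` as elements of `ℚ⟮ζ⟯`
  have hmem : ∀ m : ℕ, ζ ^ m ∈ ℚ⟮ζ⟯ := fun m => pow_mem (mem_adjoin_simple_self ℚ ζ) m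
  have hρ₀pow : ∀ m : ℕ, ρ₀ ⟨ζ ^ m, hmem m⟩ = ζ ^ ((2 * p - 1) * m) := fun m => by
    have : (⟨ζ ^ m, hmem m⟩ : ℚ⟮ζ⟯) = AdjoinSimple.gen ℚ ζ ^ m := Subtype.ext (by simp [AdjoinSimple.coe_gen])
    rw [this, map_pow, hρ₀gen, ← pow_mul]
  refine ⟨ℚ⟮ζ⟯.toSubfield, ρ₀.toRingHom, fun z hz => ?_, fun z hz => ?_, fun z hz => ?_, fun z₁ z₂ ω hω hrel => ?_⟩
  · -- `μ_{2^{a+1}p} ⊆ M`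
    obtain ⟨m, -, rfl⟩ := hζ.eq_pow_of_pow_eq_one hz
    exact hmem m
  · -- `ρ` fixes the `2^{a+1}`-th roots of unity `ζ^{m}`, `p ∣ m`
    have hzn : (z : ℂ) ^ (2 ^ (a + 1) * p) = 1 := by rw [pow_mul, hz, one_pow]
    obtain ⟨m, -, hm⟩ := hζ.eq_pow_of_pow_eq_one hzn
    have hzm : z = ⟨ζ ^ m, hmem m⟩ := Subtype.ext hm.symm
    have hpm : 2 ^ (a + 1) * p ∣ 2 ^ (a + 1) * m := hζ.dvd_of_pow_eq_one _ (by rw [mul_comm, pow_mul, hm, hz])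
    obtain ⟨m', rfl⟩ : p ∣ m := Nat.dvd_of_mul_dvd_mul_left (by positivity) hpm
    rw [hzm, AlgHom.toRingHom_eq_coe, RingHom.coe_coe, hρ₀pow]
    change ζ ^ ((2 * p - 1) * (p * m')) = ζ ^ (p * m')
    have harith : (2 * p - 1) * (p * m') = p * m' + (2 ^ (a + 1) * p) * (2 * (2 * t + 1) * m') := by
      zify [show 1 ≤ 2 * p by omega]
      rw [ht]; push_cast; ring
    rw [harith, pow_add, show ζ ^ (2 ^ (a + 1) * p * (2 * (2 * t + 1) * m')) = 1 by
      rw [pow_mul, hζ.pow_eq_one, one_pow], mul_one]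
  · -- `ρ` inverts the `p`-th roots of unity `ζ^{m}`, `2^{a+1} ∣ m`
    have hzn : (z : ℂ) ^ (2 ^ (a + 1) * p) = 1 := by rw [mul_comm, pow_mul, hz, one_pow]
    obtain ⟨m, -, hm⟩ := hζ.eq_pow_of_pow_eq_one hzn
    have hzm : z = ⟨ζ ^ m, hmem m⟩ := Subtype.ext hm.symm
    have hpm : 2 ^ (a + 1) * p ∣ p * m := hζ.dvd_of_pow_eq_one _ (by rw [mul_comm, pow_mul, hm, hz])
    obtain ⟨m', rfl⟩ : 2 ^ (a + 1) ∣ m :=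
      Nat.dvd_of_mul_dvd_mul_left hp0 (by rw [mul_comm (2 ^ (a + 1)) p] at hpm; exact hpm)
    rw [hzm, AlgHom.toRingHom_eq_coe, RingHom.coe_coe, hρ₀pow]
    change ζ ^ ((2 * p - 1) * (2 ^ (a + 1) * m')) = (ζ ^ (2 ^ (a + 1) * m'))⁻¹
    refine eq_inv_of_mul_eq_one_left ?_
    have harith : (2 * p - 1) * (2 ^ (a + 1) * m') + 2 ^ (a + 1) * m' = (2 ^ (a + 1) * p) * (2 * m') := by
      rw [← add_one_mul, show 2 * p - 1 + 1 = 2 * p by omega]; ring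
    rw [← pow_add, harith, pow_mul, hζ.pow_eq_one, one_pow]
  · -- the norm obstruction
    replace hrel : (z₁ : ℂ) * ρ₀ z₁ = ω * ((z₂ : ℂ) * ρ₀ z₂) := hrel
    by_cases hz₂ : (z₂ : ℂ) = 0
    · refine ⟨?_, hz₂⟩
      rw [hz₂, zero_mul, mul_zero] at hrel
      rcases mul_eq_zero.1 hrel with h | h
      · exact h
      · rw [map_eq_zero] at h
        rw [h]; rfl
    exfalso
    -- `w = z₁ / z₂` has `w ρ(w) = ω`
    set w : ℚ⟮ζ⟯ := z₁ / z₂ with hw_def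
    have hz₂' : z₂ ≠ 0 := fun h => hz₂ (by rw [h]; rfl)
    have hρz₂ : ρ₀ z₂ ≠ 0 := by rw [Ne, map_eq_zero]; exact hz₂'
    have hwrel : (w : ℂ) * ρ₀ w = ω := by
      rw [hw_def, map_div₀]
      push_cast
      rw [div_mul_div_comm, div_eq_iff (mul_ne_zero hz₂ hρz₂), hrel]
    -- `ω = ζ^{pj}`, `j` odd
    obtain ⟨j, hj, hωj⟩ := eq_pow_odd_of_pow_eq_neg_one hp hp2 hω
    -- `w = f(ζ)`, `f ∈ ℚ[X]`; clear denominators: `F = b f ∈ ℤ[X]`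
    have hwmem : (w : ℂ) ∈ Algebra.adjoin ℚ {ζ} := by
      rw [← adjoin_simple_toSubalgebra_of_isAlgebraic hζint.isAlgebraic]
      exact w.2
    rw [Algebra.adjoin_singleton_eq_range_aeval] at hwmem
    obtain ⟨f, hf⟩ := hwmem
    replace hf : aeval ζ f = (w : ℂ) := hf
    obtain ⟨b, hb, hF⟩ := IsLocalization.integerNormalization_spec (nonZeroDivisors ℤ) f
    set F := IsLocalization.integerNormalization (nonZeroDivisors ℤ) f with hF_def
    have hb0 : b ≠ 0 := nonZeroDivisors.ne_zero hb
    have hFζ : ∀ x : ℂ, aeval x F = (b : ℂ) * aeval x f := fun x => by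
      rw [← aeval_map_algebraMap ℚ x F, hF, map_zsmul, zsmul_eq_mul]
    -- `ρ₀ (f(ζ)) = f(ζ^{2p-1})`
    have hwgen : w = aeval (AdjoinSimple.gen ℚ ζ) f := by
      apply Subtype.ext
      have h := IntermediateField.aeval_coe (S := ℚ⟮ζ⟯) (R := ℚ) (AdjoinSimple.gen ℚ ζ) f
      rw [AdjoinSimple.coe_gen] at h
      exact hf.symm.trans h
    have hρw : ρ₀ w = aeval (ζ ^ (2 * p - 1)) f := by
      rw [hwgen]
      have h := pb.lift_aeval (ζ ^ (2 * p - 1)) hρ₀ f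
      simp only [hgen] at h
      exact h
    -- the relation in `Λ = ℤ[X]/(Φ_{2^{a+1}p})`
    set n : ℕ := b.natAbs with hn_def
    have hn : 0 < n := Int.natAbs_pos.2 hb0
    have hev := lift_exp_injective (a := a) hp0
    have hrelΛ : AdjoinRoot.mk (cyclotomic (2 ^ (a + 1) * p) ℤ) F *
        AdjoinRoot.lift (algebraMap ℤ _) (AdjoinRoot.root (cyclotomic (2 ^ (a + 1) * p) ℤ) ^ (2 * p - 1))
          (eval₂_root_pow_cyclotomic hp0 (coprime_two_mul_sub_one hp0))
            (AdjoinRoot.mk (cyclotomic (2 ^ (a + 1) * p) ℤ) F) =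
        (n : AdjoinRoot (cyclotomic (2 ^ (a + 1) * p) ℤ)) ^ 2 *
          (AdjoinRoot.root (cyclotomic (2 ^ (a + 1) * p) ℤ) ^ (p * j) * 1) := by
      apply hev
      have h1 : AdjoinRoot.lift (algebraMap ℤ ℂ) _ (eval₂_cyclotomic_exp hp0)
          (AdjoinRoot.mk (cyclotomic (2 ^ (a + 1) * p) ℤ) F) = aeval ζ F := lift_exp_mk hp0 F
      have h2 : AdjoinRoot.lift (algebraMap ℤ ℂ) _ (eval₂_cyclotomic_exp hp0)
          (AdjoinRoot.lift (algebraMap ℤ _) (AdjoinRoot.root (cyclotomic (2 ^ (a + 1) * p) ℤ) ^ (2 * p - 1))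
            (eval₂_root_pow_cyclotomic hp0 (coprime_two_mul_sub_one hp0))
              (AdjoinRoot.mk (cyclotomic (2 ^ (a + 1) * p) ℤ) F)) = aeval (ζ ^ (2 * p - 1)) F := by
        rw [AdjoinRoot.lift_mk, hom_eval₂, map_pow, AdjoinRoot.lift_root]
        have hc : (AdjoinRoot.lift (algebraMap ℤ ℂ) ζ (eval₂_cyclotomic_exp hp0)).comp
            (algebraMap ℤ (AdjoinRoot (cyclotomic (2 ^ (a + 1) * p) ℤ))) = algebraMap ℤ ℂ := Subsingleton.elim _ _
        rw [hc, ← aeval_def]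
      have hn2 : ((n : ℕ) : ℂ) ^ 2 = (b : ℂ) ^ 2 := by
        have e := congrArg (Int.cast : ℤ → ℂ) (Int.natAbs_pow_two b)
        rwa [Int.cast_pow, Int.cast_pow, Int.cast_natCast] at e
      rw [map_mul, h1, h2, map_mul, map_mul, map_pow, map_natCast, map_one, mul_one, map_pow, AdjoinRoot.lift_root,
        hn2, ← hωj, hFζ, hFζ, hf, ← hρw, ← hwrel]
      ring
    obtain ⟨s, hs⟩ := exists_pow_two_pow_eq_neg_one (a := a) hp (by rw [ht]; exact ⟨2 * t + 1, by omega⟩)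
    exact descent hp hp2 hpa hs hj n hn _ 1 1 one_ne_zero (by rw [map_one, one_pow]) hrelΛ

end Summit.HodgeConjecture.CorCM.CyclotomicTwoPowerP

end
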